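/-
Copyright (c) 2026 the pub-hodgecm-mathlib formalisation cell (harness21).  Prover seat hodgecm-mathlib-K2E5-p17 (g7), Track B «K2-LIT»,
#184♮ = hLiu418 = `stmt-HodgeConjecture-24832`; #42S organ S1, ROAD W, inert∕split witness top files (K2Liu-p01 (g9) RECIPE v2 80571dd96a2cf31d §C(hf₀out)),
cut (α) «the W3 front half: `hf₀out` for an ABSTRACT section» (K2Liu-p01 (g9) 13:47:30Z; offer 13:40:46Z).  2026-09-04.
-/
import Summits.HodgeConjecture.HodgeConjecture.Theorems.K2LiuLocalSWSpanningCriterion      -- ★ F3b (L0) `exists_compact_profile_support` (generic)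
import Summits.HodgeConjecture.HodgeConjecture.Theorems.K2LiuProfileSupportLevel           -- ★ (I) `exists_nat_level_of_compact_support` (generic)
import Summits.HodgeConjecture.HodgeConjecture.Theorems.K2LiuLocalSWDualBoxes              -- ★ (B) the boxes: `box_mono`, `isOpen_box`, `exists_mem_box`
import Summits.HodgeConjecture.HodgeConjecture.Theorems.K2LiuLocalSWBigCellCoordinate      -- ★ B4 `exists_bigCell_coordinate`
import Summits.HodgeConjecture.HodgeConjecture.Theorems.K2LiuLocalSWIwasawaCompact         -- ★ B5 `exists_isCompact_isSiegelDelta_mul`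
import Summits.HodgeConjecture.HodgeConjecture.Theorems.K2LiuUnipDeltaRankOneHaar          -- ★ `continuous_blkB_matA`
import Literature.NumberTheory.K2Lit.LocalDoublingSiegel                                   -- ★ `siegelDeltaLoc`, `mem_siegelDeltaLoc_iff_local`
import HarnessLib

/-!
# Crux `HLiu418`, organ S1, ROAD W, cut (α): THE BINDER `hf₀out` FOR AN ABSTRACT SECTION — a local Siegel section that is smooth and vanishes off the big cell
# `P_Δ w_Δ N_Δ` has its profile `u ↦ f(w_Δ u)` supported in ONE coordinate box: `∃ M₀, ∀ u ∈ N_Δ, B(u) ∉ BOX M₀ → f(w_Δ u) = 0`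

Cell `hodgecm-mathlib`, crux item hLiu418 = `stmt-HodgeConjecture-24832`, route of record `HCCMUnconditional`; squad K2 ∕ K2Liu, prover K2E5-p17 (g7).
THEOREMS ONLY (no `def`, no instance, no notation, no named-fact hypothesis, no `sorry`); lane `--supports stmt-HodgeConjecture-24832 --as helper` (count-neutral).

WHY (SPEC-S1-AssemblySocket §2 row `hf₀out`; RECIPE v2 §C(hf₀out) «★ F3b (L0) + ★ (I) ⇒ M₀(μ)»).  The socket ★ F3d-CM `localDegPS_le_of_witness` takes the binder
`hf₀out : ∀ u ∈ N_Δ(L⁺_v), u ∉ N₁ → f₀ (w_Δ u) = 0` with `N₁ = {u : B(u) ∈ Λ}`, `Λ = BOX M₀` a coordinate box (★ (B) `K2LiuLocalSWDualBoxes`).  For the witness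
`f₀ = F_{Φ₊} + μ F_{Φ₋}` this follows from three facts only — the Siegel law, smoothness, and the vanishing off the big cell (`hf₀off`, the (G)∕(m1)(R-c) letter): ★ (L0)
`exists_compact_profile_support` gives a COMPACT profile support `S₀ ⊆ N_Δ` (Iwasawa compact ★ B5 `exists_isCompact_isSiegelDelta_mul`, `N_Δ`-coordinate ★ B4
`exists_bigCell_coordinate`), and ★ (I) `exists_nat_level_of_compact_support` puts `B(S₀)` (`B = blkB ∘ matA`, continuous ★ `continuous_blkB_matA`) into ONE box of the
monotone open exhaustion `BOX m` (★ (B) `box_mono`, `isOpen_box`, `exists_mem_box`).  This file does the composition ONCE, for an ABSTRACT `f₀`, in the socket's CM letters: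
* **`exists_boxLevel_of_offBigCell`** — `∃ M₀ : ℕ, ∀ u ∈ unipDeltaLocal, blkB (matA u) ∉ BOX M₀ → f₀ (weylDelta * u) = 0` from `hf₀ : IsLocalSiegelSection χv s f₀`, smoothness
  `hfs : ∃ V open, ∀ h, ∀ k ∈ V, f₀ (h k) = f₀ h` and `hf₀off` (the socket's shape verbatim).
HONEST LABEL: HC_CM is proved only modulo the 7 printed citations (2 remaining named inputs: hLiu418 = stmt-HodgeConjecture-24832, h413 = stmt-HodgeConjecture-24833) until
rung 0 closes; count-neutral helper, closes no item.
Search: ★ (L0), ★ (I), ★ (B), ★ B4∕B5, ★ `K2LiuLocalSWSpanningOfWitnessCM` (the socket's binder shapes), ★ `mem_siegelDeltaLoc_iff_local`; dedup `rg "exists_boxLevel_of_offBigCell"` — none.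
References: [BernsteinZelevinsky1976] I. N. Bernstein, A. V. Zelevinsky, Russian Math. Surveys 31 (1976), §1.5 (locally constant functions, compact support on a cell);
[Kudla1994] Israel J. Math. 87 (1994), §3; [CasselsFrohlichANT1967] Ch. II §10 (compact-open exhaustions of a local field).
-/

set_option autoImplicit false
-- the mandated namespace repeats `HodgeConjecture.HodgeConjecture`
set_option linter.dupNamespace false

noncomputable section

open scoped Matrix Valued WithZero
open NumberField IsDedekindDomain Matrix
open Literature.NumberTheory.Automorphic Literature.NumberTheory.Automorphic.UnitaryGroup
open Literature.NumberTheory.GelbartRogawski1991 Literature.NumberTheory.GelbartRogawski1991.GRConstruction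
open Literature.NumberTheory.GelbartRogawski1991.AdaptedBlocks
open Literature.NumberTheory.GelbartRogawski1991.UnitaryDualPair
open Literature.NumberTheory.GelbartRogawski1991.UnitaryDualPair.LocalSplitting
open Literature.NumberTheory.K2Lit.SiegelDoubled Literature.NumberTheory.K2Lit.LocalSiegelDoubled
open Summit.HodgeConjecture.HodgeConjecture.Cruxes.HLiu418.K2LiuLocalSWSpanningCriterion (exists_compact_profile_support)
open Summit.HodgeConjecture.HodgeConjecture.Cruxes.HLiu418.K2LiuProfileSupportLevel (exists_nat_level_of_compact_support)
open Summit.HodgeConjecture.HodgeConjecture.Cruxes.HLiu418.K2LiuLocalSWDualBoxes (box_mono isOpen_box exists_mem_box)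
open Summit.HodgeConjecture.HodgeConjecture.Cruxes.HLiu418.K2LiuLocalSWBigCellCoordinate (exists_bigCell_coordinate)
open Summit.HodgeConjecture.HodgeConjecture.Cruxes.HLiu418.K2LiuLocalSWIwasawaCompact (exists_isCompact_isSiegelDelta_mul)
open Summit.HodgeConjecture.HodgeConjecture.Cruxes.HLiu418.K2LiuUnipDeltaRankOneHaar (continuous_blkB_matA)

namespace Summit.HodgeConjecture.HodgeConjecture.Cruxes.HLiu418.K2LiuOffBigCellProfileLevel

variable (L : Type) [Field L] [NumberField L] [IsCMField L]
variable {N M : ℕ} (e : Fin N × Fin M ≃ Fin 2)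
  (dV : Fin N → L) (hdV : ∀ i, IsCMField.complexConj L (dV i) = dV i)
  (dW : Fin M → L) (hdW : ∀ i, IsCMField.complexConj L (dW i) = dW i)
  (v : HeightOneSpectrum (𝓞 (Fp L)))

set_option maxHeartbeats 1600000 in -- MEASURED: 800000 times out at `isDefEq` (the (L0) application on the `2+2` CM doubled group; ★ F3d-CM needs 800000 for the same letters)
/-- **THE BOX LEVEL OF A SECTION OFF THE BIG CELL (`hf₀out` for an abstract `f₀`).**  At a finite place `v`, for the small doubled datum (`n = 2`) with invertible Gram
`gramR`, a uniformiser `π` of `L⁺_v` and the box parameters `(δ, c₀, e₂)` of ★ (B): every local Siegel section `f₀` (law `χ_s`) that is right-invariant under an open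
subgroup and VANISHES OFF THE BIG CELL `P_Δ w_Δ N_Δ` has `f₀ (w_Δ u) = 0` for all `u ∈ N_Δ` whose corner `B(u)` lies outside ONE box `BOX M₀`.
[cite: BernsteinZelevinsky1976, §1.5] [cite: Kudla1994, §3] [cite: CasselsFrohlichANT1967, Ch. II §10] -/
theorem exists_boxLevel_of_offBigCell (hT₀d : IsUnit (gramR L e dV hdV dW hdW).det) {π : v.adicCompletion (Fp L)}
    (hπ : Valued.v π = WithZero.exp (-1 : ℤ)) (δ : L) (c₀ e₂ : ℤ)
    (χv : ∀ w : PlacesOver L v, (w.1.adicCompletion L)ˣ →* ℂˣ) (s : ℂ)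
    {f₀ : UnitaryGroup.localPi L (IsCMField.complexConj L) (2 + 2) (hermD L e dV hdV dW hdW) v → ℂ}
    (hf₀ : haveI : Algebra.IsQuadraticExtension (Fp L) L := IsCMField.isQuadraticExtension L
      IsLocalSiegelSection (Fp L) L (IsCMField.complexConj L) (complexConj_imagUnit L) (imagUnit_ne_zero L) (imagUnit_mul_self L)
        v 2 (gramR_isSymm L e dV hdV dW hdW) (hermD_eq_map_gramD L e dV hdV dW hdW) χv s f₀)
    (hfs : ∃ V : Subgroup (UnitaryGroup.localPi L (IsCMField.complexConj L) (2 + 2) (hermD L e dV hdV dW hdW) v),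
      IsOpen (V : Set (UnitaryGroup.localPi L (IsCMField.complexConj L) (2 + 2) (hermD L e dV hdV dW hdW) v)) ∧ ∀ h, ∀ k ∈ V, f₀ (h * k) = f₀ h)
    (hf₀off : ∀ h, (¬ ∃ p ∈ siegelDeltaLoc L e dV hdV dW hdW v, ∃ u ∈ unipDeltaLocal (Fp L) L (IsCMField.complexConj L) v 2 (JD := hermD L e dV hdV dW hdW),
      h = p * weylDelta (Fp L) L (IsCMField.complexConj L) v 2 (hermD_eq_map_gramD L e dV hdV dW hdW) * u) → f₀ h = 0) :
    ∃ M₀ : ℕ, ∀ u ∈ unipDeltaLocal (Fp L) L (IsCMField.complexConj L) v 2 (JD := hermD L e dV hdV dW hdW),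
      blkB (matA (Fp L) L (IsCMField.complexConj L) v 2 u) ∉
          {t : Matrix (Fin 2) (Fin 2) (LocalRing L v) | ∀ i j (w : PlacesOver L v),
            Valued.v ((algebraMap L (LocalRing L v) δ • (gramS (Fp L) L v 2 (gramR L e dV hdV dW hdW) * t)) i j w) ≤
              Valued.v (toPlace v w π) ^ (c₀ - (M₀ : ℤ) - if i = j then e₂ else 0)} →
        f₀ (weylDelta (Fp L) L (IsCMField.complexConj L) v 2 (hermD_eq_map_gramD L e dV hdV dW hdW) * u) = 0 := by
  haveI : Algebra.IsQuadraticExtension (Fp L) L := IsCMField.isQuadraticExtension L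
  -- the Iwasawa compact and the `N_Δ`-coordinate of the big cell
  obtain ⟨K₀, hK₀c, hIw⟩ := exists_isCompact_isSiegelDelta_mul (Fp L) L (IsCMField.complexConj L) (complexConj_imagUnit L) (imagUnit_ne_zero L)
    (imagUnit_mul_self L) v 2 (gramR_isSymm L e dV hdV dW hdW) (hermD_eq_map_gramD L e dV hdV dW hdW) hT₀d
  obtain ⟨ν, hνc, hν⟩ := exists_bigCell_coordinate (Fp L) L (IsCMField.complexConj L) (complexConj_imagUnit L) (imagUnit_ne_zero L)
    (imagUnit_mul_self L) v 2 (gramR_isSymm L e dV hdV dW hdW) hT₀d (hermD_eq_map_gramD L e dV hdV dW hdW)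
  have hmem : ∀ p, p ∈ siegelDeltaLoc L e dV hdV dW hdW v ↔ LocalSplitting.IsSiegelDelta (Fp L) L (IsCMField.complexConj L) (complexConj_imagUnit L) (imagUnit_ne_zero L)
      (imagUnit_mul_self L) v 2 (gramR_isSymm L e dV hdV dW hdW) (hermD_eq_map_gramD L e dV hdV dW hdW) p := fun p => mem_siegelDeltaLoc_iff_local L e dV hdV dW hdW v p
  have hΩ : {h : UnitaryGroup.localPi L (IsCMField.complexConj L) (2 + 2) (hermD L e dV hdV dW hdW) v |
      ∃ p ∈ siegelDeltaLoc L e dV hdV dW hdW v, ∃ u ∈ unipDeltaLocal (Fp L) L (IsCMField.complexConj L) v 2 (JD := hermD L e dV hdV dW hdW),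
        h = p * weylDelta (Fp L) L (IsCMField.complexConj L) v 2 (hermD_eq_map_gramD L e dV hdV dW hdW) * u} =
      {g | ∃ p, LocalSplitting.IsSiegelDelta (Fp L) L (IsCMField.complexConj L) (complexConj_imagUnit L) (imagUnit_ne_zero L) (imagUnit_mul_self L) v 2
        (gramR_isSymm L e dV hdV dW hdW) (hermD_eq_map_gramD L e dV hdV dW hdW) p ∧
        ∃ u ∈ unipDeltaLocal (Fp L) L (IsCMField.complexConj L) v 2 (JD := hermD L e dV hdV dW hdW),
          g = p * weylDelta (Fp L) L (IsCMField.complexConj L) v 2 (hermD_eq_map_gramD L e dV hdV dW hdW) * u} := by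
    ext g
    simp only [Set.mem_setOf_eq, hmem]
  -- (L0): compact profile support
  obtain ⟨S₀, hS₀c, hS₀N, hS₀⟩ := exists_compact_profile_support (P := siegelDeltaLoc L e dV hdV dW hdW v)
    (N := unipDeltaLocal (Fp L) L (IsCMField.complexConj L) v 2 (JD := hermD L e dV hdV dW hdW))
    (χ := localSiegelCharacter (Fp L) L (IsCMField.complexConj L) v 2 χv s) hK₀c
    (fun g => by obtain ⟨p, hp, k, hk, rfl⟩ := hIw g; exact ⟨p, (hmem p).2 hp, k, hk, rfl⟩)
    (w := weylDelta (Fp L) L (IsCMField.complexConj L) v 2 (hermD_eq_map_gramD L e dV hdV dW hdW)) (ν := ν) (by rw [hΩ]; exact hνc)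
    (fun p hp u hu => hν p ((hmem p).1 hp) u hu) (f := f₀) (fun p hp h => hf₀ p ((hmem p).1 hp) h) hfs hf₀off
  -- (I): one box
  exact exists_nat_level_of_compact_support (fun g => blkB (matA (Fp L) L (IsCMField.complexConj L) v 2 g))
    (continuous_blkB_matA (Fp L) L (IsCMField.complexConj L) v 2 (JD := hermD L e dV hdV dW hdW)).continuousOn
    (box := fun m : ℤ => {t : Matrix (Fin 2) (Fin 2) (LocalRing L v) | ∀ i j (w : PlacesOver L v),
      Valued.v ((algebraMap L (LocalRing L v) δ • (gramS (Fp L) L v 2 (gramR L e dV hdV dW hdW) * t)) i j w) ≤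
        Valued.v (toPlace v w π) ^ (c₀ - m - if i = j then e₂ else 0)})
    (fun m m' h => box_mono (Fp L) L v hπ δ c₀ e₂ h) (fun m => isOpen_box (Fp L) L v hπ δ c₀ e₂ m) (fun t => exists_mem_box (Fp L) L v hπ δ c₀ e₂ t)
    hS₀c hS₀N (F := fun u => f₀ (weylDelta (Fp L) L (IsCMField.complexConj L) v 2 (hermD_eq_map_gramD L e dV hdV dW hdW) * u)) hS₀

end Summit.HodgeConjecture.HodgeConjecture.Cruxes.HLiu418.K2LiuOffBigCellProfileLevel

end
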